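/-
Copyright (c) 2026 the pub-hodgecm-mathlib formalisation cell (harness21).  Prover seat hodgecm-mathlib-K2E1-p16 (g2), Track B «K2-LIT» ENGINE E1, h413 = `stmt-HodgeConjecture-24833`,
route `HCCMUnconditional`, R90-S8 «ContSpec-n½» #2∕#3 chain, T1 FILE 2 (S8 dealer R90-CS-plan (g2), S8-R103 (1) ∕ S8-R126): THE CROSS `K_U`-AVERAGE PACKAGES `hΞ₁…hΞ₄` OF THE
SECTION-GENERIC MAASS–SELBERG RELATION FOR TWO PAIR SECTIONS SHARING THE MIDDLE CHARACTER — the torus dependence is the idele-class character `χ₁·conj χ₁′` of the first entry.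
-/
import Summits.HodgeConjecture.HodgeConjecture.Theorems.K2E1ChiMaassSelbergPairingsCMThree    -- ★ p862940 (this seat): T1 FILE 1, the same-pair case; brings ★ `IsChiSectionPair`
import HarnessLib

/-!
# h413 ∕ R90-S8 T1 FILE 2 — `K2E1ChiMaassSelbergCrossBracketsCMThree`: THE CROSS `K_U`-AVERAGE PACKAGES OF ★ `maassSelberg_flatSectionU_cm_three_final'` FOR PAIR SECTIONS

Cell `pub/hodgecm-mathlib`, crux H413 = `stmt-HodgeConjecture-24833`; census `K2/K2E1-p16/g2/CENSUS-T1.md`.  THEOREMS ONLY (no `def`, no `instance`, no notation, no named-fact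
hypothesis, no `sorry`); lane `--supports stmt-HodgeConjecture-24833 --as helper` (count-neutral).  Generic CM-type data `F E c` at `N = 3`.

THE MATHEMATICS ([MoeglinWaldspurger1995, II.1.7, IV.2.3]; [Arthur1980TraceFormulaII, §4]).  The section-generic Maass–Selberg relation on the tube (★ final′, K2E4-p14) takes four
`K_U`-AVERAGE letters `hΞᵢ`: «`∫_K Φ(t k)·conj Ψ(t k) dμ_K = Ξ(d₀ t)` for every `t ∈ T(𝔸)`» for the four coefficient pairs `(Φ, Ψ) ∈ {φ, φ̃} × {φ′, φ̃′}` (`φ̃` the intertwined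
coefficient), each `Ξ` measurable, bounded, invariant under `L^×` and `ℝ_{>0}`.  For the χ-family ALL FOUR pairs are pairs of PAIR SECTIONS SHARING THE MIDDLE CHARACTER: `φ, φ′` are
`(χ₁, χ₂)`-sections and, by ★ p861904 `isChiSectionPair_intertwinedCoeff_three`, `φ̃, φ̃′` are `(χ₁ʷ, χ₂)`-sections (`χ₁ʷ = reflectChar c χ₁`).  For a `(χ₁, χ₂)`-section `Φ` and a
`(χ₁′, χ₂)`-section `Ψ` with `χ₂` unitary, `Φ(bk)·conj Ψ(bk) = χ₁(b₀₀)·conj χ₁′(b₀₀)·|χ₂(b₁₁)|²·Φ(k)·conj Ψ(k)` (§2), so the torus dependence of the `K`-pairing is the character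
`η = χ₁·conj χ₁′` of the FIRST ENTRY `b₀₀ = d₀ b` (§1: final′'s `diagUnit _ 0` is ★ `firstEntryUnit`), and `Ξ := η · ∫_K Φ conj Ψ` satisfies all five inputs (§4): measurable (Hecke characters
are continuous), bounded by unitarity, `L^×`-invariant (★ `HeckeCharacter.map_principal`), `ℝ_{>0}`-invariant for ray-trivial `χ₁, χ₁′`.  Its idelic bracket is
`[Ξ] = (∫_K Φ conj Ψ)·∫_{{‖x‖≤1}∩𝓕_I} ‖x‖·η(x) dν_I` (§5), decided BY NAME by ★ `K2E1TorusHeightMellin.bracket_one` (`η = 1`: `χ₁′ = χ₁`, the brackets `[Ξ₁]`, `[Ξ₄]` — and `[Ξ₂]`, `[Ξ₃]`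
in the SELF-ASSOCIATE case `χ₁ʷ = χ₁`) ∕ ★ `bracket_character_eq_zero` (`η ≠ 1` on norm-one classes: the cross brackets `[Ξ₂] = [Ξ₃] = 0`, the relation is TWO-TERM, `w ≡ 0` in ★ p862829).
* §1 `firstEntryUnit_eq_diagUnit_zero`.
* §2 `cross_borel_mul_mul_conj`, §3 `torusAverage_cross_eq`.
* §4 HEAD **`xi_package_cross`** — the five `Ξ`-inputs of ★ final′ for `Ξ := fun x => (χ₁ x·conj (χ₁′ x))·∫_K Φ conj Ψ`, one conjunction in final′'s bytes; serves `hΞ₁` (`χ₁′ = χ₁`),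
  `hΞ₂`∕`hΞ₃` (one side reflected), `hΞ₄` (both reflected) with ★ p861904.
* §5 `bracket_cross_eq` — the constant leaves the idelic bracket.
HONEST LABEL: HC_CM is proved only modulo the 7 printed citations (2 remaining named inputs: hLiu418 = `stmt-HodgeConjecture-24832`, h413 = `stmt-HodgeConjecture-24833`) until rung 0
closes; this file asserts no named fact and closes no socket; count-neutral; visible letters: the two pair-section properties, unitarity of `χ₁, χ₁′, χ₂`, ray-triviality of `χ₁, χ₁′`;
remaining T1 letters: `hdec′` (FILE 3, K2E2-p12 (g9)), the road transfer `hFtube` (FILE 4), and the character-bracket dichotomy applied by name.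

## References
* [MoeglinWaldspurger1995] C. Mœglin, J.-L. Waldspurger, *Spectral decomposition and Eisenstein series* (1995), II.1.7, IV.2.3.
* [Arthur1980TraceFormulaII] J. Arthur, *A trace formula for reductive groups II*, Compositio Math. 40 (1980), §4.
* [Rogawski1990] J. D. Rogawski, *Automorphic Representations of Unitary Groups in Three Variables* (1990), §1.10.
-/

set_option autoImplicit false
-- the mandated namespace repeats `HodgeConjecture.HodgeConjecture`, as in every `Theorems/*.lean` of this sub-problem
set_option linter.dupNamespace false

noncomputable section

open MeasureTheory Measure NumberField IsDedekindDomain Set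
open scoped ENNReal NNReal ComplexConjugate
open Literature.NumberTheory Literature.NumberTheory.Automorphic Literature.NumberTheory.Automorphic.UnitaryGroup AdelicGroupData
open Literature.NumberTheory.Automorphic.Arthur2013.Leaves.TECR
open Literature.NumberTheory.GaloisRepresentations (HeckeCharacter)
open Summit.HodgeConjecture.HodgeConjecture.Cruxes.H413.K2E1BorelEisensteinU
open Summit.HodgeConjecture.HodgeConjecture.Cruxes.H413.K2E1CharacterEisensteinU2Defs
open Summit.HodgeConjecture.HodgeConjecture.Cruxes.H413.K2E1CharacterEisensteinU3PairDefs

namespace Summit.HodgeConjecture.HodgeConjecture.Cruxes.H413.K2E1ChiMaassSelbergCrossBracketsCMThree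

variable {F E : Type} [Field F] [NumberField F] [Field E] [NumberField E] [Algebra F E] {c : E ≃ₐ[F] E}
variable {χ₁ χ₁' : HeckeCharacter E} {χ₂ : ↥(TorusDict.torus c) →ₜ* ℂˣ} {φ ψ : (quasiSplit F E c 3).Adelic → ℂ}

/-! ## §1 final′'s first diagonal unit is ★ `firstEntryUnit` -/

/-- **`firstEntryUnit hb = diagUnit hb 0`** — the idele `b₀₀` in the two spellings (★ K2-defs0 ∕ ★ `UnitaryGroupBorelSemidirect`); both are `⟨b₀₀, (b⁻¹)₀₀, _, _⟩`. [cite: Rogawski1990, §1.10] -/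
theorem firstEntryUnit_eq_diagUnit_zero {b : (quasiSplit F E c 3).Adelic} (hb : b ∈ borelAdelic F E c 3) : firstEntryUnit hb = diagUnit hb 0 :=
  Units.ext rfl

/-! ## §2 The torus dependence of the cross pairing is the character `χ₁·conj χ₁′` of the first entry -/

/-- **`Φ(bk)·conj Ψ(bk) = (χ₁(b₀₀)·conj χ₁′(b₀₀))·(Φ(k)·conj Ψ(k))`** for a `(χ₁, χ₂)`-section `Φ`, a `(χ₁′, χ₂)`-section `Ψ`, `χ₂` UNITARY, `b ∈ B(𝔸)` (★ `IsChiSectionPair.borel_mul`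
twice; `|χ₂(b₁₁)|² = 1`). [cite: MoeglinWaldspurger1995, II.1.7, IV.2.3] -/
theorem cross_borel_mul_mul_conj (hφ : IsChiSectionPair χ₁ χ₂ φ) (hψ : IsChiSectionPair χ₁' χ₂ ψ) (hχ₂u : ∀ u, ‖((χ₂ u : ℂˣ) : ℂ)‖ = 1)
    {b : (quasiSplit F E c 3).Adelic} (hb : b ∈ borelAdelic F E c 3) (k : (quasiSplit F E c 3).Adelic) :
    φ (b * k) * conj (ψ (b * k)) =
      (((χ₁ (firstEntryUnit hb) : ℂˣ) : ℂ) * conj ((χ₁' (firstEntryUnit hb) : ℂˣ) : ℂ)) * (φ k * conj (ψ k)) := by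
  rw [hφ.borel_mul hb k, hψ.borel_mul hb k]
  set c₂ : ℂ := ((χ₂ (middleEntryUnitary hb) : ℂˣ) : ℂ) with hc₂
  have h2 : c₂ * conj c₂ = 1 := by rw [Complex.mul_conj, Complex.normSq_eq_norm_sq, hc₂, hχ₂u]; norm_num
  rw [map_mul, map_mul]
  calc ((χ₁ (firstEntryUnit hb) : ℂˣ) : ℂ) * c₂ * φ k * (conj ((χ₁' (firstEntryUnit hb) : ℂˣ) : ℂ) * conj c₂ * conj (ψ k))
      = (c₂ * conj c₂) * ((((χ₁ (firstEntryUnit hb) : ℂˣ) : ℂ) * conj ((χ₁' (firstEntryUnit hb) : ℂˣ) : ℂ)) * (φ k * conj (ψ k))) := by ring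
    _ = (((χ₁ (firstEntryUnit hb) : ℂˣ) : ℂ) * conj ((χ₁' (firstEntryUnit hb) : ℂˣ) : ℂ)) * (φ k * conj (ψ k)) := by rw [h2, one_mul]

/-! ## §3 The torus average -/

variable [MeasurableSpace (quasiSplit F E c 3).Adelic]

/-- **THE CROSS `K`-AVERAGE ALONG THE TORUS**: for every subgroup `K ≤ G(𝔸)`, every measure on it and every `t ∈ T(𝔸)`,
`∫_K Φ(t k)·conj Ψ(t k) dμ_K = (χ₁(d₀t)·conj χ₁′(d₀t))·∫_K Φ conj Ψ dμ_K`, `d₀ t = diagUnit _ 0 = t₀₀`. [cite: MoeglinWaldspurger1995, IV.2.3] -/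
theorem torusAverage_cross_eq (hφ : IsChiSectionPair χ₁ χ₂ φ) (hψ : IsChiSectionPair χ₁' χ₂ ψ) (hχ₂u : ∀ u, ‖((χ₂ u : ℂˣ) : ℂ)‖ = 1)
    (K : Subgroup (quasiSplit F E c 3).Adelic) (μK : Measure ↥K) (t : ↥(torusInBorel F E c 3)) :
    ∫ k : ↥K, φ (((t : borelAdelic F E c 3) : (quasiSplit F E c 3).Adelic) * (k : (quasiSplit F E c 3).Adelic)) *
        conj (ψ (((t : borelAdelic F E c 3) : (quasiSplit F E c 3).Adelic) * (k : (quasiSplit F E c 3).Adelic))) ∂μK =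
      (((χ₁ (diagUnit (t : borelAdelic F E c 3).2 0) : ℂˣ) : ℂ) * conj ((χ₁' (diagUnit (t : borelAdelic F E c 3).2 0) : ℂˣ) : ℂ)) *
        ∫ k : ↥K, φ (k : (quasiSplit F E c 3).Adelic) * conj (ψ (k : (quasiSplit F E c 3).Adelic)) ∂μK := by
  rw [← firstEntryUnit_eq_diagUnit_zero, ← integral_const_mul]
  exact integral_congr_ae (Filter.Eventually.of_forall fun k => cross_borel_mul_mul_conj hφ hψ hχ₂u (t : borelAdelic F E c 3).2 (k : (quasiSplit F E c 3).Adelic))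

/-! ## §4 HEAD: the `Ξ`-package of ★ final′ for a cross pair of pair sections -/

variable [MeasurableSpace (AdeleRing (𝓞 E) E)ˣ] [BorelSpace (AdeleRing (𝓞 E) E)ˣ]

/-- **THE FIVE `Ξ`-INPUTS OF ★ `maassSelberg_flatSectionU_cm_three_final'` FOR A `(χ₁, χ₂)`-SECTION `Φ` AGAINST A `(χ₁′, χ₂)`-SECTION `Ψ`, WITH `Ξ := (χ₁·conj χ₁′)·∫_K Φ conj Ψ`:**
(1) measurable (Hecke characters are continuous); (2) `‖Ξ x‖ ≤ ‖∫_K Φ conj Ψ‖` (`χ₁, χ₁′` unitary); (3) invariance under principal ideles (★ `HeckeCharacter.map_principal`); (4) invariance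
under `ℝ_{>0}` (`χ₁, χ₁′` ray-trivial: `χ(posRealIdele r) = 1`); (5) the `K`-average identity (§3) — in final′'s bytes (`t : torusInBorel`, `diagUnit t.2 0`), for every subgroup `K ≤ G(𝔸)` and
measure.  With ★ p861904 (`φ̃` is a `(reflectChar c χ₁, χ₂)`-section) this ONE lemma serves `hΞ₁` (`χ₁′ = χ₁`), `hΞ₂` (`Ψ = φ̃′`), `hΞ₃` (`Φ = φ̃`), `hΞ₄` (both).
[cite: MoeglinWaldspurger1995, IV.2.3] [cite: Arthur1980TraceFormulaII, §4] -/
theorem xi_package_cross (hφ : IsChiSectionPair χ₁ χ₂ φ) (hψ : IsChiSectionPair χ₁' χ₂ ψ)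
    (hχ₁u : ∀ x, ‖((χ₁ x : ℂˣ) : ℂ)‖ = 1) (hχ₁'u : ∀ x, ‖((χ₁' x : ℂˣ) : ℂ)‖ = 1) (hχ₂u : ∀ u, ‖((χ₂ u : ℂˣ) : ℂ)‖ = 1)
    (hχ₁ray : ∀ r : ℝ≥0ˣ, χ₁ (posRealIdele E r) = 1) (hχ₁'ray : ∀ r : ℝ≥0ˣ, χ₁' (posRealIdele E r) = 1)
    (K : Subgroup (quasiSplit F E c 3).Adelic) (μK : Measure ↥K) :
    Measurable (fun x : (AdeleRing (𝓞 E) E)ˣ => (((χ₁ x : ℂˣ) : ℂ) * conj ((χ₁' x : ℂˣ) : ℂ)) *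
      ∫ k : ↥K, φ (k : (quasiSplit F E c 3).Adelic) * conj (ψ (k : (quasiSplit F E c 3).Adelic)) ∂μK) ∧
    (∀ x : (AdeleRing (𝓞 E) E)ˣ, ‖(fun x : (AdeleRing (𝓞 E) E)ˣ => (((χ₁ x : ℂˣ) : ℂ) * conj ((χ₁' x : ℂˣ) : ℂ)) *
      ∫ k : ↥K, φ (k : (quasiSplit F E c 3).Adelic) * conj (ψ (k : (quasiSplit F E c 3).Adelic)) ∂μK) x‖ ≤
      ‖∫ k : ↥K, φ (k : (quasiSplit F E c 3).Adelic) * conj (ψ (k : (quasiSplit F E c 3).Adelic)) ∂μK‖) ∧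
    (∀ q ∈ GaloisRepresentations.principalIdeles E, ∀ x : (AdeleRing (𝓞 E) E)ˣ,
      (fun x : (AdeleRing (𝓞 E) E)ˣ => (((χ₁ x : ℂˣ) : ℂ) * conj ((χ₁' x : ℂˣ) : ℂ)) *
        ∫ k : ↥K, φ (k : (quasiSplit F E c 3).Adelic) * conj (ψ (k : (quasiSplit F E c 3).Adelic)) ∂μK) (q * x) =
      (fun x : (AdeleRing (𝓞 E) E)ˣ => (((χ₁ x : ℂˣ) : ℂ) * conj ((χ₁' x : ℂˣ) : ℂ)) *
        ∫ k : ↥K, φ (k : (quasiSplit F E c 3).Adelic) * conj (ψ (k : (quasiSplit F E c 3).Adelic)) ∂μK) x) ∧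
    (∀ (r : ℝ≥0ˣ) (x : (AdeleRing (𝓞 E) E)ˣ),
      (fun x : (AdeleRing (𝓞 E) E)ˣ => (((χ₁ x : ℂˣ) : ℂ) * conj ((χ₁' x : ℂˣ) : ℂ)) *
        ∫ k : ↥K, φ (k : (quasiSplit F E c 3).Adelic) * conj (ψ (k : (quasiSplit F E c 3).Adelic)) ∂μK) (posRealIdele E r * x) =
      (fun x : (AdeleRing (𝓞 E) E)ˣ => (((χ₁ x : ℂˣ) : ℂ) * conj ((χ₁' x : ℂˣ) : ℂ)) *
        ∫ k : ↥K, φ (k : (quasiSplit F E c 3).Adelic) * conj (ψ (k : (quasiSplit F E c 3).Adelic)) ∂μK) x) ∧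
    (∀ t : ↥(torusInBorel F E c 3),
      ∫ k : ↥K, φ (((t : borelAdelic F E c 3) : (quasiSplit F E c 3).Adelic) * (k : (quasiSplit F E c 3).Adelic)) *
          conj (ψ (((t : borelAdelic F E c 3) : (quasiSplit F E c 3).Adelic) * (k : (quasiSplit F E c 3).Adelic))) ∂μK =
        (fun x : (AdeleRing (𝓞 E) E)ˣ => (((χ₁ x : ℂˣ) : ℂ) * conj ((χ₁' x : ℂˣ) : ℂ)) *
          ∫ k : ↥K, φ (k : (quasiSplit F E c 3).Adelic) * conj (ψ (k : (quasiSplit F E c 3).Adelic)) ∂μK) (diagUnit (t : borelAdelic F E c 3).2 0)) := by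
  have hm₁ : Measurable fun x : (AdeleRing (𝓞 E) E)ˣ => ((χ₁ x : ℂˣ) : ℂ) := (Units.continuous_val.comp (map_continuous χ₁)).measurable
  have hm₁' : Measurable fun x : (AdeleRing (𝓞 E) E)ˣ => conj ((χ₁' x : ℂˣ) : ℂ) := (Complex.continuous_conj.comp (Units.continuous_val.comp (map_continuous χ₁'))).measurable
  refine ⟨(hm₁.mul hm₁').mul_const _, fun x => ?_, fun q hq x => ?_, fun r x => ?_, fun t => torusAverage_cross_eq hφ hψ hχ₂u K μK t⟩
  · rw [norm_mul, norm_mul, RCLike.norm_conj, hχ₁u, hχ₁'u, one_mul, one_mul]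
  · simp only [map_mul, HeckeCharacter.map_principal χ₁ hq, HeckeCharacter.map_principal χ₁' hq, one_mul]
  · simp only [map_mul, hχ₁ray, hχ₁'ray, one_mul]

/-! ## §5 The bracket: the constant leaves the idelic integral -/

omit [BorelSpace (AdeleRing (𝓞 E) E)ˣ] in
/-- **`[Ξ] = (∫_K Φ conj Ψ)·∫_{{‖x‖≤1}∩𝓕_I} ‖x‖·(χ₁ x·conj χ₁′ x) dν_I`** — the `K`-pairing constant leaves the idelic bracket of ★ final′; the remaining CHARACTER BRACKET is decided by name
(★ `K2E1TorusHeightMellin.bracket_one` for `χ₁′ = χ₁` on norm-one classes, ★ `bracket_character_eq_zero` otherwise). [cite: MoeglinWaldspurger1995, IV.2.3] -/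
theorem bracket_cross_eq (νI : Measure (AdeleRing (𝓞 E) E)ˣ) (S : Set (AdeleRing (𝓞 E) E)ˣ) (C : ℂ) :
    (∫ x in S, ((IdeleClassGroup.ideleNorm E x : ℝ) : ℂ) * ((((χ₁ x : ℂˣ) : ℂ) * conj ((χ₁' x : ℂˣ) : ℂ)) * C) ∂νI) =
      C * ∫ x in S, ((IdeleClassGroup.ideleNorm E x : ℝ) : ℂ) * (((χ₁ x : ℂˣ) : ℂ) * conj ((χ₁' x : ℂˣ) : ℂ)) ∂νI := by
  rw [← integral_const_mul]
  refine integral_congr_ae (Filter.Eventually.of_forall fun x => ?_)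
  ring

end Summit.HodgeConjecture.HodgeConjecture.Cruxes.H413.K2E1ChiMaassSelbergCrossBracketsCMThree

end
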